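import Literature.Computability.Complexity.GateEliminationCase54Q24

/-!
# Gate elimination: Case 5.4.1.4.2.2 of Li–Yang's Theorem 4.1

"When `F` is a `1`-gate, we can do a constant substitution to `v` such that we are able to
replace `A` by a constant. This would make `F` a `0`-gate, so we can remove it by Rule 1.
Furthermore, a descendent of `A` can be removed via Rule 3. Recall that `v` is a `2⁺` variable …
Therefore, there is another descendent of `v` that can be removed via Rule 3 (again, if this
coincides with the descendent of `A`, then it would become trivial, further degenerating a
descendent). The trivialization of `A` does not introduce any potential, since `v` is a constant
by then, and `F` is fed by a ⊕-gate `D`. The removal of `F` introduces no potential either …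
Hence during the process, `4` gates are eliminated with `ΔΦ ≤ 2`, resulting in
`Δμ ≥ 4 - 2α_φ + α_I ≥ δ`." (ECCC TR21-023, §4.1, Case 5.4.1.4.2.2; the paper's `A` is our `Y`.)
PROVED here as `stepGoal_quad22` (hypothesis `hQ22` of `stepGoal_quadratic_aux`).

## References

* J. Li, T. Yang, *3.1n − o(n) circuit lower bounds for explicit functions*, STOC 2022;
  ECCC TR21-023, §3.3, §4.1 (Case 5.4.1.4.2.2), Lemma 3.11.
-/

namespace Literature.Computability.Complexity

open Finset

namespace Semicircuit

variable {n : ℕ} {f : (Fin n → ZMod 2) → Bool} {d : ℕ} {αφ αI αQ : ℝ}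

/-- A potential-non-increasing packing after deleting a `0`-gate whose variable wires are
`≤ 2`-variables and whose gate wires do not become troubled (they do not become `1`-gates, or are
not ∧-type). [cite: LiYang2022, §3.3 (Rule 1), Prop. 3.10] -/
theorem exists_packing_removeGate_noNew'' (D : Semicircuit n) (k₀ : Fin D.m) {m' : ℕ}
    (ε : Fin m' ≃ {k : Fin D.m // k ≠ k₀}) (h0 : ∀ k a, D.arg k a ≠ .gate k₀)
    {P : Finset (Fin D.m × Fin D.m)} (hP : D.IsPacking P)
    (hvar : ∀ a v, D.arg k₀ a = .var v → D.fanout (.var v) ≤ 2)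
    (hgate : ∀ a g, D.arg k₀ a = .gate g →
      D.fanout (.gate g) ≠ (univ.filter fun a' : Fin 2 => D.arg k₀ a' = .gate g).card + 1 ∨ ¬ IsAndOp (D.op g)) :
    ∃ P' : Finset (Fin m' × Fin m'), (D.removeGate k₀ ε).IsPacking P' ∧ (D.removeGate k₀ ε).potential P' ≤ D.potential P := by
  classical
  have hcov : ∀ k, (D.removeGate k₀ ε).Troubled k → ¬ D.Troubled ((ε k : Fin D.m)) →
      k ∈ (∅ : Finset _) ∨ k ∈ (∅ : Finset _) := by
    intro k hT' hT
    exfalso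
    obtain ⟨a, ha⟩ := D.causedBy_of_new_troubled_removeGate k₀ ε h0 hT' hT
    cases hka : D.arg k₀ a with
    | const c => rw [hka] at ha; exact not_causedBy_const ha
    | gate g =>
      rw [hka] at ha
      rcases ha with ha | ⟨z, hz, -⟩
      · have hkg : (ε k : Fin D.m) = g := (Node.gate.inj ha).symm
        rcases hgate a g hka with h3 | h3
        · have h1 := D.fanout_removeGate_add k₀ ε h0 (v := .gate g) (fun h => by cases h; exact h0 k₀ a hka)
          have hskip : (Node.gate g : Node n D.m).skip k₀ ε = .gate k := by
            rw [← hkg]; exact Node.skip_gate_coe k₀ ε k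
          rw [hskip] at h1
          have := hT'.2.1
          omega
        · apply h3; rw [← hkg]; exact hT'.1
      · cases hz
    | var v =>
      rw [hka] at ha
      rcases ha with ha | ⟨z, hz, a', ha'⟩
      · cases ha
      · cases hz
        have h1 := D.fanout_removeGate_add k₀ ε h0 (v := .var v) (fun h => by cases h)
        have h2 : 1 ≤ (univ.filter fun a'' : Fin 2 => D.arg k₀ a'' = .var v).card :=
          card_pos.mpr ⟨a, mem_filter.mpr ⟨mem_univ _, hka⟩⟩
        have h3 := hvar a v hka
        have h4 := hT'.fanout_eq_two ha'
        change (D.removeGate k₀ ε).fanout (.var v) + _ = _ at h1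
        omega
  have := exists_packing_transfer' D (D.removeGate k₀ ε) (fun k => (ε k : Fin D.m))
    (fun a b h => ε.injective (Subtype.ext h)) hP
    (fun k k' _ _ _ _ h => D.adjacent_removeGate_of k₀ ε k k' h) ∅ ∅ hcov (Or.inl (by simp)) (Or.inl (by simp))
  simpa using this

variable {C : Semicircuit n} {R : RdqSource n} {G : Fin C.m} {x y : Fin n} {B C' D : Fin C.m} {aX aB aC aD : Fin 2}

/-- **Case 5.4.1.4.2.2 of the proof of Thm. 4.1**: the other reader `F` of `D` is a `1`-gate
reading the `2`-variable `u'`, and its reader `Y` is an ∧-type `1`-gate reading `F` and a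
`2`-variable `v`. The killing constant to `v` trivializes `Y` (no new troubled gate), `F` becomes
a `0`-gate and is deleted (Rule 1, no potential increase since `D` is ⊕-type), and two more doomed
gates go (the reader of `Y`, the other reader of `v`): `Δμ ≥ 4 - 2α_φ + α_I ≥ δ`.
[cite: LiYang2022, §4.1 (Case 5.4.1.4.2.2)] -/
theorem stepGoal_quad22 (hf : IsAffineDisperser f d) (hd : 2 * d + 2 < R.dim) (hF : C.Fair)
    (hC : C.ComputesRestr f R) (hS : C.Standing R) (hcfg : C.Case5Config G x y B C' D aX aB aC aD)
    (hφ0 : 0 < αφ) (hI0 : 0 < αI)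
    {E : Fin C.m} {u : Fin n} (hDn : ¬ IsAndOp (C.op D)) (hIu : C.arg D aD.rev = .var u)
    (hu1 : C.fanout (.var u) = 1) (hEand : IsAndOp (C.op E))
    {F : Fin C.m} {aF : Fin 2} {u' : Fin n} (hFD : C.arg F aF = .gate D) (hFu : C.arg F aF.rev = .var u')
    (hF1 : C.fanout (.gate F) = 1) (hu'2 : C.fanout (.var u') = 2)
    {Y : Fin C.m} {aY : Fin 2} {v : Fin n} (hYand : IsAndOp (C.op Y)) (hYF : C.arg Y aY = .gate F)
    (hYv : C.arg Y aY.rev = .var v) (hY1 : C.fanout (.gate Y) = 1) (hv2 : C.fanout (.var v) = 2) (hvu : v ≠ u') :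
    C.StepGoal f R αφ αI αQ := by
  classical
  have hφ' := hφ0.le
  have hI' := hI0.le
  have hN := hS.normalized.1
  have hGK := hcfg.G_not_mem
  have hDK : D ∉ C.xorPart := fun hDK => hGK (C.mem_of_arg_eq D hDK aD G hcfg.arg_D)
  have hEK : E ∉ C.xorPart := C.not_mem_xorPart_of_isAndOp hEand
  have hFK : F ∉ C.xorPart := fun h => hDK (C.mem_of_arg_eq F h aF D hFD)
  have hYK : Y ∉ C.xorPart := C.not_mem_xorPart_of_isAndOp hYand
  have hFD' : F ≠ D := fun h => by rw [h] at hFD; exact C.arg_ne_self_of_not_mem hDK _ hFD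
  have hYF' : Y ≠ F := fun h => by rw [h] at hYF; exact C.arg_ne_self_of_not_mem hFK _ hYF
  have hFG : F ≠ G := by
    intro h; rw [h] at hFD
    rcases fin2_eq_or_eq_rev aX aF with e' | e'
    · rw [e', hcfg.arg_G_x] at hFD; cases hFD
    · rw [e', hcfg.arg_G_y] at hFD; cases hFD
  have hYD : Y ≠ D := by
    intro h; rw [h] at hYF
    rcases fin2_eq_or_eq_rev aD aY with e' | e'
    · rw [e', hcfg.arg_D] at hYF; cases hYF; exact hFG rfl
    · rw [e', hIu] at hYF; cases hYF
  have hvuu : v ≠ u := by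
    intro h; rw [h] at hYv; have := two_le_fanout hIu hYv hYD.symm; omega
  have hv : R.Free v := free_of_reads hC hYv
  have hvp : ¬ R.Protected v := fun h => hS.protected_not_and v h Y aY.rev hYv hYand
  have hFout : C.out ≠ .gate F := out_ne_of_read_bYacyclic hS hYK ⟨aY, hYF⟩
  have hYout : C.out ≠ .gate Y := by
    -- `Y` has a reader
    intro h
    obtain ⟨ko, hko⟩ := exists_out_eq_gate' hf hF hC (by omega)
    have hkY : ko = Y := by rw [h] at hko; exact (Node.gate.inj hko).symm
    have h0 : C.fanout (.gate Y) = 0 := by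
      rw [← hkY]; exact (fanout_eq_zero_iff _ _).mpr (not_reads_out_of_standing hf (by omega) hF hC hS hko)
    omega
  obtain ⟨ko, hko⟩ := exists_out_eq_gate' hf hF hC (by omega)
  -- the only reader of `F` is `Y`
  have hreadF : ∀ k a, C.arg k a = .gate F → k = Y := by
    intro k a h; by_contra hk; have := two_le_fanout hYF h (fun h' => hk h'.symm); omega
  -- the reader `H` of `Y`, the other reader `P` of `v`
  obtain ⟨H, aH, hHY⟩ := exists_reader_of_fanout_pos (D := C) (by omega : 0 < C.fanout (.gate Y))
  have hHY' : H ≠ Y := fun h => by rw [h] at hHY; exact C.arg_ne_self_of_not_mem hYK _ hHY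
  have hHF : H ≠ F := by
    intro h; rw [h] at hHY
    rcases fin2_eq_or_eq_rev aF aH with e' | e'
    · rw [e', hFD] at hHY; cases hHY; exact hYD rfl
    · rw [e', hFu] at hHY; cases hHY
  have hYv1 : (univ.filter fun a : Fin 2 => C.arg Y a = .var v).card ≤ 1 := by
    rw [card_le_one]
    intro a ha b' hb'
    rw [mem_filter] at ha hb'
    have key : ∀ a', C.arg Y a' = .var v → a' = aY.rev := by
      intro a' h
      rcases fin2_eq_or_eq_rev aY a' with e' | e'
      · rw [e', hYF] at h; cases h
      · exact e'
    rw [key a ha.2, key b' hb'.2]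
  obtain ⟨P, aP, hPY, hPv⟩ := exists_reader_ne (by omega : 2 ≤ C.fanout (.var v)) hYv1
  have hPF : P ≠ F := by
    intro h; rw [h] at hPv
    rcases fin2_eq_or_eq_rev aF aP with e' | e'
    · rw [e', hFD] at hPv; cases hPv
    · rw [e', hFu] at hPv; cases hPv; exact hvu rfl
  have hPD : P ≠ D := by
    intro h; rw [h] at hPv
    rcases fin2_eq_or_eq_rev aD aP with e' | e'
    · rw [e', hcfg.arg_D] at hPv; cases hPv
    · rw [e', hIu] at hPv; cases hPv; exact hvuu rfl
  -- step 1: `v := c`, the killing constant of `Y`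
  obtain ⟨c, hc⟩ := exists_trivializing hYand aY.rev
  let c' : ZMod 2 := finTwoEquiv.symm c
  have hc' : finTwoEquiv c' = c := finTwoEquiv.apply_symm_apply c
  let C₁ := C.substConst v (finTwoEquiv c')
  let R₁ := R.assignFree v c' hv hvp
  have hF₁ : C₁.Fair := hF.substConst v _
  have hC₁ : C₁.ComputesRestr f R₁ := hC.substConst_assignFree hv hvp c'
  have hP₁ : C₁.IsPacking (C.substConstPacking v (finTwoEquiv c') ∅) := C.isPacking_empty.substConst
  have hd₁ : 2 * d + 2 ≤ R₁.dim := by have := RdqSource.dim_assignFree (b := c') hv hvp; change R₁.dim + 1 = R.dim at this; omega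
  have hdim₁ : R₁.dim + 1 = R.dim := RdqSource.dim_assignFree (b := c') hv hvp
  have hvar₁ : ∀ {k : Fin C.m} {a : Fin 2} {w : Fin n}, w ≠ v → (C₁.arg k a = .var w ↔ C.arg k a = .var w) := by
    intro k a w hwv
    show (C.arg k a).substConst v _ = .var w ↔ _
    cases hka : C.arg k a with
    | const cc => exact ⟨(fun h => by cases h), fun h => by cases h⟩
    | var i =>
      by_cases hiv : i = v
      · rw [hiv, Node.substConst_var_self]; exact ⟨(fun h => by cases h), fun h => by cases h; exact absurd rfl hwv⟩
      · rw [Node.substConst_var_of_ne hiv]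
    | gate g => exact ⟨(fun h => by cases h), fun h => by cases h⟩
  have hgate₁ : ∀ {k : Fin C.m} {a : Fin 2} {g : Fin C.m}, C₁.arg k a = .gate g ↔ C.arg k a = .gate g :=
    fun {k a g} => Node.substConst_eq_gate_iff
  have hconst₁ : ∀ {k : Fin C.m} {a : Fin 2}, C.arg k a = .var v → C₁.arg k a = .const c := by
    intro k a h; show (C.arg k a).substConst v _ = _; rw [h, Node.substConst_var_self]
    show Node.const (finTwoEquiv c') = Node.const c; rw [hc']
  have hY₁c : C₁.arg Y aY.rev = .const c := hconst₁ hYv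
  have hY₁F : C₁.arg Y aY = .gate F := hgate₁.mpr hYF
  have hF₁D : C₁.arg F aF = .gate D := hgate₁.mpr hFD
  have hF₁u : C₁.arg F aF.rev = .var u' := (hvar₁ hvu.symm).mpr hFu
  have hP₁c : C₁.arg P aP = .const c := hconst₁ hPv
  have hH₁Y : C₁.arg H aH = .gate Y := hgate₁.mpr hHY
  have hC₁out : C₁.out = .gate ko := by show C.out.substConst v _ = _; rw [hko]; rfl
  have htrivY : C₁.liveFn Y aY.rev c false = C₁.liveFn Y aY.rev c true := hc
  have hout₁Y : C₁.out ≠ .gate Y := out_ne_of_trivialized hf (by omega) hF₁ hC₁ hY₁c htrivY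
  let E₁ := elimDataWTriv hF₁ hC₁ hP₁ hY₁c htrivY hout₁Y hφ' hI' αQ
  have hr₁ : ∃ r₁, E₁.repl = .const r₁ := ⟨_, rfl⟩
  obtain ⟨kF₁, hkF₁⟩ := E₁.ι_surj F hYF'.symm
  obtain ⟨kD₁, hkD₁⟩ := E₁.ι_surj D hYD.symm
  obtain ⟨kH₁, hkH₁⟩ := E₁.ι_surj H hHY'
  obtain ⟨kP₁, hkP₁⟩ := E₁.ι_surj P hPY
  have hF₁D' : E₁.C'.arg kF₁ aF = .gate kD₁ := by rw [E₁.arg_eq_gate_iff, hkF₁, hkD₁]; exact Or.inl hF₁D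
  have hF₁u' : E₁.C'.arg kF₁ aF.rev = .var u' := by rw [E₁.arg_eq_var_iff, hkF₁]; exact Or.inl hF₁u
  have hP₁c' : E₁.C'.arg kP₁ aP = .const c := (E₁.arg_eq_const_iff kP₁ aP c).mpr (Or.inl (by rw [hkP₁]; exact hP₁c))
  have hH₁c : ∃ cH, E₁.C'.arg kH₁ aH = .const cH := by
    obtain ⟨r₁, hr₁'⟩ := hr₁
    exact ⟨r₁, (E₁.arg_eq_const_iff kH₁ aH r₁).mpr (Or.inr ⟨by rw [hkH₁]; exact hH₁Y, hr₁'⟩)⟩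
  -- no new troubled gate when `Y` goes
  have hnonew₁ : ∀ k', E₁.C'.Troubled k' → ¬ C₁.Troubled (E₁.ι k') → False := by
    intro k' hT' hT
    obtain ⟨a, ha⟩ := E₁.causedBy_of_new_troubled k' hT' hT
    rcases fin2_eq_or_eq_rev aY a with e' | e'
    · rw [e', hY₁F] at ha
      rcases ha with ha | ⟨z, hz, -⟩
      · have hk : E₁.ι k' = F := (Node.gate.inj ha).symm
        have hk' : k' = kF₁ := E₁.ι_injective (hk.trans hkF₁.symm)
        rw [hk'] at hT'
        obtain ⟨w, hw⟩ := hT'.arg_isVar aF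
        rw [hF₁D'] at hw; cases hw
      · cases hz
    · rw [e', hY₁c] at ha; exact not_causedBy_const ha
  obtain ⟨P₁', hP₁', hpot₁⟩ := E₁.exists_packing_of_cover hP₁ ∅ ∅ (fun k' hT' hT => (hnonew₁ k' hT' hT).elim)
    (Or.inl (by simp)) (Or.inl (by simp))
  simp only [if_true, Nat.cast_zero, add_zero] at hpot₁
  -- step 2: `F` is a `0`-gate: delete it
  have hfF₁ : E₁.C'.fanout (.gate kF₁) = 0 := by
    obtain ⟨r₁, hr₁'⟩ := hr₁
    have h1 := E₁.fanout_gate_add (k' := kF₁) (by rw [hr₁']; exact fun h => by cases h)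
    rw [hkF₁] at h1
    have h2 : 1 ≤ (univ.filter fun a : Fin 2 => C₁.arg Y a = .gate F).card :=
      card_pos.mpr ⟨aY, mem_filter.mpr ⟨mem_univ _, hY₁F⟩⟩
    have h3 : C₁.fanout (.gate F) = 1 := by show (C.substConst v (finTwoEquiv c')).fanout (.gate F) = 1; rw [C.fanout_substConst_gate]; exact hF1
    omega
  have hno₂ : ∀ k a, E₁.C'.arg k a ≠ .gate kF₁ := (fanout_eq_zero_iff _ _).mp hfF₁
  have hout₁F : E₁.C'.out ≠ .gate kF₁ := by
    intro h
    have e1 := E₁.out_eq; rw [if_neg hout₁Y, hC₁out, h] at e1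
    change Node.gate (E₁.ι kF₁) = Node.gate ko at e1
    rw [hkF₁] at e1; cases e1; exact hFout hko
  let ε₂ := E₁.C'.skipEquiv kF₁
  let C₂ := E₁.C'.removeGate kF₁ ε₂
  have hF₂ : C₂.Fair := E₁.fair.removeGate ε₂ hno₂
  have hC₂ : C₂.ComputesRestr f R₁ := E₁.computes.removeGate ε₂ E₁.fair hno₂ hout₁F
  have hopD₁ : E₁.C'.op kD₁ = C.op D := by rw [elimDataWTriv_op, hkD₁]
  have hvarF : ∀ a w, E₁.C'.arg kF₁ a = .var w → E₁.C'.fanout (.var w) ≤ 2 := by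
    intro a w hw
    rcases fin2_eq_or_eq_rev aF a with e' | e'
    · rw [e', hF₁D'] at hw; cases hw
    · rw [e', hF₁u'] at hw; cases hw
      obtain ⟨r₁, hr₁'⟩ := hr₁
      have h1 := E₁.fanout_var_add (i := u') (by rw [hr₁']; exact fun h => by cases h)
      have h2 : C₁.fanout (.var u') = 2 := by
        show (C.substConst v (finTwoEquiv c')).fanout (.var u') = 2; rw [C.fanout_substConst_var_of_ne v _ hvu.symm]; exact hu'2
      omega
  have hgateF : ∀ a g, E₁.C'.arg kF₁ a = .gate g →
      E₁.C'.fanout (.gate g) ≠ (univ.filter fun a' : Fin 2 => E₁.C'.arg kF₁ a' = .gate g).card + 1 ∨ ¬ IsAndOp (E₁.C'.op g) := by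
    intro a g hg
    rcases fin2_eq_or_eq_rev aF a with e' | e'
    · rw [e', hF₁D'] at hg; cases hg; right; rw [hopD₁]; exact hDn
    · rw [e', hF₁u'] at hg; cases hg
  obtain ⟨P₂, hP₂, hpot₂⟩ := exists_packing_removeGate_noNew'' E₁.C' kF₁ ε₂ hno₂ hP₁' hvarF hgateF
  -- step 3: two doomed gates in `C₂`
  have hkHF₁ : kH₁ ≠ kF₁ := fun h => hHF (by rw [← hkH₁, ← hkF₁, h])
  have hkPF₁ : kP₁ ≠ kF₁ := fun h => hPF (by rw [← hkP₁, ← hkF₁, h])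
  let kH₂ : Fin C₂.m := ε₂.symm ⟨kH₁, hkHF₁⟩
  let kP₂ : Fin C₂.m := ε₂.symm ⟨kP₁, hkPF₁⟩
  have hεH : (ε₂ kH₂ : Fin E₁.C'.m) = kH₁ := by show ((ε₂ (ε₂.symm ⟨kH₁, hkHF₁⟩)) : Fin E₁.C'.m) = kH₁; rw [Equiv.apply_symm_apply ε₂]
  have hεP : (ε₂ kP₂ : Fin E₁.C'.m) = kP₁ := by show ((ε₂ (ε₂.symm ⟨kP₁, hkPF₁⟩)) : Fin E₁.C'.m) = kP₁; rw [Equiv.apply_symm_apply ε₂]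
  have hH₂c : ∃ cH, C₂.arg kH₂ aH = .const cH := by
    obtain ⟨cH, hcH⟩ := hH₁c
    exact ⟨cH, by show (E₁.C'.arg (ε₂ kH₂) aH).skip kF₁ ε₂ = _; rw [hεH, hcH]; rfl⟩
  have hP₂c : C₂.arg kP₂ aP = .const c := by show (E₁.C'.arg (ε₂ kP₂) aP).skip kF₁ ε₂ = _; rw [hεP, hP₁c']; rfl
  have hH₂d : kH₂ ∈ C₂.doomed := by obtain ⟨cH, hcH⟩ := hH₂c; exact C₂.mem_doomed_of_const hcH
  have hP₂d : kP₂ ∈ C₂.doomed := C₂.mem_doomed_of_const hP₂c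
  have htwo : 2 ≤ C₂.doomed.card := by
    by_cases hHP : H = P
    · -- `H = P` reads two constants: syntactically constant, so a reader of it is doomed too
      have hkHP : kH₂ = kP₂ := by
        apply ε₂.injective; apply Subtype.ext; rw [hεH, hεP]
        exact E₁.ι_injective (by rw [hkH₁, hkP₁, hHP])
      have haHP : aH ≠ aP := by
        intro h; have h1 := hHY; rw [hHP, h, hPv] at h1; cases h1
      obtain ⟨cH, hcH⟩ := hH₂c
      rw [hkHP] at hcH
      have hsyn : ∃ bb, C₂.SynVal (.gate kP₂) bb := by
        rcases fin2_eq_or_eq_rev 0 aP with e0 | e0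
        · have e1 : aH = 1 := by
            rcases fin2_eq_or_eq_rev 0 aH with e1 | e1
            · exact absurd (e1.trans e0.symm) haHP
            · rw [e1]; rfl
          have h0 : C₂.arg kP₂ 0 = .const c := by rw [show (0 : Fin 2) = aP from e0.symm]; exact hP₂c
          have h1 : C₂.arg kP₂ 1 = .const cH := by rw [show (1 : Fin 2) = aH from e1.symm]; exact hcH
          exact ⟨_, SynVal.both (by rw [h0]; exact SynVal.const _) (by rw [h1]; exact SynVal.const _) rfl⟩
        · have e0' : aP = 1 := by rw [e0]; rfl
          have e1 : aH = 0 := by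
            rcases fin2_eq_or_eq_rev 0 aH with e1 | e1
            · exact e1
            · exact absurd ((show aH = 1 by rw [e1]; rfl).trans e0'.symm) haHP
          have h1 : C₂.arg kP₂ 1 = .const c := by rw [show (1 : Fin 2) = aP from e0'.symm]; exact hP₂c
          have h0 : C₂.arg kP₂ 0 = .const cH := by rw [show (0 : Fin 2) = aH from e1.symm]; exact hcH
          exact ⟨_, SynVal.both (by rw [h0]; exact SynVal.const _) (by rw [h1]; exact SynVal.const _) rfl⟩
      obtain ⟨bb, hbb⟩ := hsyn
      have hPout : C.out ≠ .gate P := fun hh =>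
        out_ne_of_synVal hf (by omega) hF₂ hC₂ hbb (by
          have e1 := E₁.out_eq; rw [if_neg hout₁Y, hC₁out] at e1
          have ho₁ : E₁.C'.out = .gate kP₁ := by
            apply E₁.embed_injective
            show E₁.C'.out.embed E₁.ι = (Node.gate kP₁ : Node n _).embed E₁.ι
            rw [e1]; show Node.gate ko = Node.gate (E₁.ι kP₁); rw [hkP₁, ← hh, hko]
          show E₁.C'.out.skip kF₁ ε₂ = .gate kP₂
          rw [ho₁]; exact Node.skip_gate_of_ne kF₁ ε₂ hkPF₁)
      have hPpos : 0 < C.fanout (.gate P) := by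
        by_contra hh; push Not at hh
        exact hPout (hN.out_of_fanout_eq_zero P (by omega))
      obtain ⟨Z, aZ, hZP⟩ := exists_reader_of_fanout_pos (D := C) hPpos
      have hPK : P ∉ C.xorPart := fun hPK => hYK (C.mem_of_arg_eq P hPK aH Y (by rw [← hHP]; exact hHY))
      have hZP' : Z ≠ P := fun h => by rw [h] at hZP; exact C.arg_ne_self_of_not_mem hPK _ hZP
      have hZY : Z ≠ Y := by
        intro h; rw [h] at hZP
        rcases fin2_eq_or_eq_rev aY aZ with e' | e'
        · rw [e', hYF] at hZP; cases hZP; exact hPF rfl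
        · rw [e', hYv] at hZP; cases hZP
      have hZF : Z ≠ F := by
        intro h; rw [h] at hZP
        rcases fin2_eq_or_eq_rev aF aZ with e' | e'
        · rw [e', hFD] at hZP; cases hZP; exact hPD rfl
        · rw [e', hFu] at hZP; cases hZP
      obtain ⟨kZ₁, hkZ₁⟩ := E₁.ι_surj Z hZY
      have hkZF₁ : kZ₁ ≠ kF₁ := fun h => hZF (by rw [← hkZ₁, ← hkF₁, h])
      let kZ₂ : Fin C₂.m := ε₂.symm ⟨kZ₁, hkZF₁⟩
      have hεZ : (ε₂ kZ₂ : Fin E₁.C'.m) = kZ₁ := by show ((ε₂ (ε₂.symm ⟨kZ₁, hkZF₁⟩)) : Fin E₁.C'.m) = kZ₁; rw [Equiv.apply_symm_apply ε₂]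
      have hZ₁P : E₁.C'.arg kZ₁ aZ = .gate kP₁ := by rw [E₁.arg_eq_gate_iff, hkZ₁, hkP₁]; exact Or.inl (hgate₁.mpr hZP)
      have hZ₂P : C₂.arg kZ₂ aZ = .gate kP₂ := by
        show (E₁.C'.arg (ε₂ kZ₂) aZ).skip kF₁ ε₂ = _; rw [hεZ, hZ₁P]; exact Node.skip_gate_of_ne kF₁ ε₂ hkPF₁
      have hZ₂d : kZ₂ ∈ C₂.doomed := C₂.mem_doomed_of_reads hZ₂P hbb
      have hkZP : kZ₂ ≠ kP₂ := by
        intro h; have : (ε₂ kZ₂ : Fin E₁.C'.m) = (ε₂ kP₂ : Fin E₁.C'.m) := by rw [h]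
        rw [hεZ, hεP] at this; exact hZP' (by rw [← hkZ₁, ← hkP₁, this])
      have hsub : ({kZ₂, kP₂} : Finset _) ⊆ C₂.doomed := by
        intro k hk; rw [mem_insert, mem_singleton] at hk
        rcases hk with rfl | rfl
        · exact hZ₂d
        · exact hP₂d
      have := card_le_card hsub
      rwa [card_pair hkZP] at this
    · have hkHP : kH₂ ≠ kP₂ := by
        intro h; have : (ε₂ kH₂ : Fin E₁.C'.m) = (ε₂ kP₂ : Fin E₁.C'.m) := by rw [h]
        rw [hεH, hεP] at this; exact hHP (by rw [← hkH₁, ← hkP₁, this])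
      have hsub : ({kH₂, kP₂} : Finset _) ⊆ C₂.doomed := by
        intro k hk; rw [mem_insert, mem_singleton] at hk
        rcases hk with rfl | rfl
        · exact hH₂d
        · exact hP₂d
      have := card_le_card hsub
      rwa [card_pair hkHP] at this
  obtain ⟨D', P', hF', hCD', hP', hm', hμ'⟩ := cascade_doomed hf hd₁ hφ' hI' αQ 2 C₂ P₂ hF₂ hC₂ hP₂ htwo
  -- accounting
  have hvinf : v ∈ C.influential R := C.mem_influential_of_reads R hYv
  have hμ₁ := measure_substConst_le hφ' αI αQ C.isPacking_empty R R₁ v (finTwoEquiv c')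
  have hinf₁ : (1 : ℝ) ≤ ((C.influential R).card : ℝ) - (C₁.influential R₁).card := by
    have h1 : (C₁.influential R₁).card ≤ ((C.influential R).erase v).card :=
      card_le_card (C.influential_substConst_assignFree_subset hv hvp c' (finTwoEquiv c'))
    have h3 := card_erase_add_one hvinf
    have : (C₁.influential R₁).card + 1 ≤ (C.influential R).card := by omega
    have : ((C₁.influential R₁).card : ℝ) + 1 ≤ (C.influential R).card := by exact_mod_cast this
    linarith
  have hq₁ : ((R.quadCount : ℝ) - (R₁.quadCount : ℝ)) = 0 := by
    have : R₁.quadCount = R.quadCount := RdqSource.quadCount_assignFree hv hvp; rw [this]; ring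
  have hmE₁ : (E₁.C'.m : ℝ) + 1 = C₁.m := by exact_mod_cast E₁.m_add_one
  have hinfE₁ : ((E₁.C'.influential R₁).card : ℝ) ≤ (C₁.influential R₁).card := by
    exact_mod_cast card_le_card (E₁.influential_subset R₁)
  have hμE₁ : E₁.C'.measure αφ αI αQ P₁' R₁ ≤ C₁.measure αφ αI αQ (C.substConstPacking v (finTwoEquiv c') ∅) R₁ - 1 := by
    unfold measure
    nlinarith [mul_le_mul_of_nonneg_left hinfE₁ hI', mul_le_mul_of_nonneg_left hpot₁ hφ']
  have hm₂ : (C₂.m : ℝ) + 1 = E₁.C'.m := by exact_mod_cast E₁.C'.removeGate_m_add_one kF₁ ε₂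
  have hinf₂ : ((C₂.influential R₁).card : ℝ) ≤ (E₁.C'.influential R₁).card := by
    exact_mod_cast card_le_card (E₁.C'.influential_removeGate_subset kF₁ ε₂ hno₂ R₁)
  have hpot₂' : (C₂.potential P₂ : ℝ) ≤ E₁.C'.potential P₁' := by exact_mod_cast hpot₂
  have hμ₂ : C₂.measure αφ αI αQ P₂ R₁ ≤ E₁.C'.measure αφ αI αQ P₁' R₁ - 1 := by
    unfold measure
    nlinarith [mul_le_mul_of_nonneg_left hinf₂ hI', mul_le_mul_of_nonneg_left hpot₂' hφ']
  refine Or.inr ⟨1, le_rfl, by norm_num, D', R₁, P', hF', hCD', hP', hdim₁, ?_⟩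
  have hδ := liYangDelta_le_case3 αφ αI αQ
  rw [hq₁] at hμ₁
  have hαI₁ := mul_le_mul_of_nonneg_left hinf₁ hI'
  push_cast at hμ' ⊢
  simp only [mul_one]
  nlinarith [hμ₁, hμE₁, hμ₂, hμ', hαI₁, hφ']

end Semicircuit

end Literature.Computability.Complexity
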